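import Literature.NumberTheory.Rogawski1990.FinExplicitTransferFactorStableInvariance   -- ★ `finCharpolyTwo_eq_of_isLocalStablyConjH` (`charpoly` of the `U(Φ₂)`-part is a stable class function)
import Literature.NumberTheory.Rogawski1990.Ch12Sec5Defs                              -- ★ TR dictionary `EllipticData` (fields `DH`, `regH`)
import Literature.NumberTheory.Rogawski1990.CMLocalAPacketMembers                      -- ★ `Gqs`
import HarnessLib

/-!
# F0 · P3c · line LH6 «StCharTS» — «DH-STABLE★»: the field pin `DH := DG₂ ∘ Prod.fst` (★ DG-FIELD-TWO) makes `D_H` a STABLE class function on `H_v` —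
# the `hDHst` hypothesis of ★ S13c `upDom_of_upDef`, and `hRegH` from the H-FIELDS pin (P2) [Rogawski1990, §4.9 pp. 54–55; §3.1 p. 19; §12.5 p. 183]

Cell `pub/hodgecm-mathlib`, crux H413 = `stmt-HodgeConjecture-24833` (lane `--kind proof --supports … --as helper`), route HCCMUnconditional; seat LH4-p01 (g5); datum road of LH6
(map owner LH6-p01 (g4)), self-dealt S-glue «DH-STABLE★» announced 13:0xZ (rule §2.3) after ★ S13c (p851427 · p851520 · p851529).  THEOREMS ONLY (no definition, no
instance, no notation, no named fact, no `sorry`); ★-only imports.  HONEST LABEL: HC_CM is proved only modulo the 7 printed citations (2 remaining: hLiu418 =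
`stmt-HodgeConjecture-24832`, h413 = `stmt-HodgeConjecture-24833`) until rung 0 closes; count-neutral (junction-level: two FIELD hypotheses of the (U2)+(HCB-up)+(UPR) fold
— `hDHst`, `hRegH` of ★ `upDom_of_upDef` — become consequences of the H-FIELDS pins (P2) `regH ↔ G-regular` and (P6) `DH := DG₂ ∘ Prod.fst` with ★ DG-FIELD-TWO's letters).

THE MATHEMATICS.  ★ `F0P3cStCharTSDGFieldTwo.exists_DG_field_two` characterises the `U(Φ₂)`-weight `DG₂` by two letters: `DG₂ γ = 0` if `discr(charpoly γ)` is not a unit, and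
`DG₂ γ = √√‖u‖` whenever `u·det γ = discr(charpoly γ)` (`u` a unit).  Both letters read `γ` only through `charpoly γ` (and `det γ = coeff₀`), which is a STABLE class
function on `H_v` (stable conjugacy = `GL₂(∏ L_w) × GL₁`-conjugacy, ★ `finCharpolyTwo_eq_of_isLocalStablyConjH`); hence any field `DH` pinned to `DG₂ ∘ Prod.fst` is constant on
`H_v`-stable classes (`DH_eq_of_isLocalStablyConjH`) — in particular the `hDHst` text of ★ S13c (`hDHst_of_pin`, `G`-regularity not even needed).  `hRegH_of_pin`: the
one direction of (P2) that ★ S13c consumes.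

## References
* [Rogawski1990] J. D. Rogawski, *Automorphic Representations of Unitary Groups in Three Variables*, Ann. of Math. Stud. 123 (1990): §4.9 pp. 54–55 (`D_H`); §3.1 p. 19 (stable
  conjugacy); §12.5 Lemma 12.5.1 p. 183.
* [HarishChandra1999AdmissibleDistributions] Harish-Chandra, *Admissible invariant distributions on reductive p-adic groups*, AMS ULS 16 (1999): §17 (the weight `|D|^{1/2}`).
-/

set_option autoImplicit false
-- the mandated namespace has the single-problem summit's repeated segment (`HodgeConjecture.HodgeConjecture`)
set_option linter.dupNamespace false

noncomputable section

open NumberField IsDedekindDomain Matrix Polynomial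
open scoped MatrixGroups NNReal
open Literature.NumberTheory.Rogawski1990 Literature.NumberTheory.Automorphic Literature.NumberTheory.Automorphic.UnitaryGroup

namespace Summit.HodgeConjecture.HodgeConjecture.Cruxes.H413.F0P3cStCharTSDHStable

variable (L : Type) [Field L] [NumberField L] [IsCMField L] (v : HeightOneSpectrum (𝓞 ↥(maximalRealSubfield L)))

/-- **A `DG₂`-pinned weight is a stable class function.**  If `DG₂ : U(Φ₂)(L⁺_v) → ℝ` satisfies ★ DG-FIELD-TWO's two letters (`0` off the unit-discriminant locus;
`√√‖u‖` at `u·det γ = discr(charpoly γ)`), then `DG₂ g′ = DG₂ g` whenever `(g′, u′)` and `(g, u)` are stably conjugate in `H_v` (indeed whenever `charpoly g′ = charpoly g`).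
[cite: Rogawski1990, §4.9 pp. 54–55; §3.1 p. 19] -/
theorem DG₂_eq_of_isLocalStablyConjH
    (DG₂ : (UnitaryGroup.cmDatum L 2 (Matrix.of fun i j : Fin 2 => if i.val + j.val + 1 = 2 then (1 : L) else 0)).Local v → ℝ)
    (h0 : ∀ γ : (UnitaryGroup.cmDatum L 2 (Matrix.of fun i j : Fin 2 => if i.val + j.val + 1 = 2 then (1 : L) else 0)).Local v,
      ¬ IsUnit ((γ.val.val.charpoly).discr) → DG₂ γ = 0)
    (hu : ∀ (γ : (UnitaryGroup.cmDatum L 2 (Matrix.of fun i j : Fin 2 => if i.val + j.val + 1 = 2 then (1 : L) else 0)).Local v)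
      (u : (UnitaryGroup.LocalRing L v)ˣ),
      (u : UnitaryGroup.LocalRing L v) * (γ.val.val.det) ^ (2 - 1) = (γ.val.val.charpoly).discr →
        DG₂ γ = ((NNReal.sqrt (NNReal.sqrt (unitModulusChar (UnitaryGroup.LocalRing L v) u)) : ℝ≥0) : ℝ))
    {a b : (UnitaryGroup.cmDatum L 2 (Matrix.of fun i j : Fin 2 => if i.val + j.val + 1 = 2 then (1 : L) else 0)).Local v ×
      (UnitaryGroup.cmDatum L 1 (Matrix.of fun i j : Fin 1 => if i.val + j.val + 1 = 1 then (1 : L) else 0)).Local v}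
    (h : IsLocalStablyConjH L v a b) : DG₂ b.1 = DG₂ a.1 := by
  -- equal characteristic polynomials, hence equal determinants and discriminants
  have hχ : b.1.val.val.charpoly = a.1.val.val.charpoly := by
    have := finCharpolyTwo_eq_of_isLocalStablyConjH L v h
    unfold finCharpolyTwo at this
    exact this
  have hdet : b.1.val.val.det = a.1.val.val.det := by
    rw [Matrix.det_eq_sign_charpoly_coeff, Matrix.det_eq_sign_charpoly_coeff, hχ]
  by_cases hdisc : IsUnit (a.1.val.val.charpoly).discr
  · -- the unit `u := discr · det⁻¹` works for both
    set du : (UnitaryGroup.LocalRing L v)ˣ := Matrix.GeneralLinearGroup.det (a.1.val : GL (Fin 2) (UnitaryGroup.LocalRing L v)) with hdu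
    have hduv : (du : UnitaryGroup.LocalRing L v) = a.1.val.val.det := by rw [hdu, Matrix.GeneralLinearGroup.val_det_apply]
    set u : (UnitaryGroup.LocalRing L v)ˣ := hdisc.unit * du⁻¹ with huu
    have hua : (u : UnitaryGroup.LocalRing L v) * (a.1.val.val.det) ^ (2 - 1) = (a.1.val.val.charpoly).discr := by
      rw [show (2 - 1 : ℕ) = 1 from rfl, pow_one, huu, Units.val_mul, ← hduv, mul_assoc, Units.inv_mul, mul_one, IsUnit.unit_spec]
    have hub : (u : UnitaryGroup.LocalRing L v) * (b.1.val.val.det) ^ (2 - 1) = (b.1.val.val.charpoly).discr := by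
      rw [hdet, hχ]; exact hua
    rw [hu _ u hub, hu _ u hua]
  · have hdiscb : ¬ IsUnit (b.1.val.val.charpoly).discr := by rw [hχ]; exact hdisc
    rw [h0 _ hdiscb, h0 _ hdisc]

/-- **`hDHst` from the pin `DH := DG₂ ∘ Prod.fst`.**  For a §12.5 datum `𝔇` on `(G, H_v)` whose field `DH` is pinned to a `DG₂` with ★ DG-FIELD-TWO's letters, `D_H` is
constant on `H_v`-stable classes — the exact `hDHst` hypothesis of ★ S13c `F0P3cStCharTSUpDom.upDom_of_upDef` (its `G`-regularity antecedent is not needed).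
[cite: Rogawski1990, §4.9 pp. 54–55; §12.5 Lemma 12.5.1 p. 183] -/
theorem hDHst_of_pin {G : Type} [Group G] [TopologicalSpace G] [IsTopologicalGroup G] [MeasurableSpace G]
    [∀ γ : G, MeasurableSpace (G ⧸ Subgroup.centralizer ({γ} : Set G))] [MeasurableSpace (G ⧸ Subgroup.center G)]
    [MeasurableSpace ((UnitaryGroup.cmDatum L 2 (Matrix.of fun i j : Fin 2 => if i.val + j.val + 1 = 2 then (1 : L) else 0)).Local v ×
      (UnitaryGroup.cmDatum L 1 (Matrix.of fun i j : Fin 1 => if i.val + j.val + 1 = 1 then (1 : L) else 0)).Local v)]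
    (𝔇 : Ch12Sec5.EllipticData G
      ((UnitaryGroup.cmDatum L 2 (Matrix.of fun i j : Fin 2 => if i.val + j.val + 1 = 2 then (1 : L) else 0)).Local v ×
        (UnitaryGroup.cmDatum L 1 (Matrix.of fun i j : Fin 1 => if i.val + j.val + 1 = 1 then (1 : L) else 0)).Local v))
    (DG₂ : (UnitaryGroup.cmDatum L 2 (Matrix.of fun i j : Fin 2 => if i.val + j.val + 1 = 2 then (1 : L) else 0)).Local v → ℝ)
    (h0 : ∀ γ : (UnitaryGroup.cmDatum L 2 (Matrix.of fun i j : Fin 2 => if i.val + j.val + 1 = 2 then (1 : L) else 0)).Local v,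
      ¬ IsUnit ((γ.val.val.charpoly).discr) → DG₂ γ = 0)
    (hu : ∀ (γ : (UnitaryGroup.cmDatum L 2 (Matrix.of fun i j : Fin 2 => if i.val + j.val + 1 = 2 then (1 : L) else 0)).Local v)
      (u : (UnitaryGroup.LocalRing L v)ˣ),
      (u : UnitaryGroup.LocalRing L v) * (γ.val.val.det) ^ (2 - 1) = (γ.val.val.charpoly).discr →
        DG₂ γ = ((NNReal.sqrt (NNReal.sqrt (unitModulusChar (UnitaryGroup.LocalRing L v) u)) : ℝ≥0) : ℝ))
    (hDHf : ∀ s, 𝔇.DH s = DG₂ s.1) :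
    ∀ a b, IsLocalGRegular L v a → IsLocalStablyConjH L v a b → 𝔇.DH b = 𝔇.DH a := by
  intro a b _ h
  rw [hDHf, hDHf]
  exact DG₂_eq_of_isLocalStablyConjH L v DG₂ h0 hu h

/-- **`hRegH` from the pin (P2) `regH ↔ G-regular`** — the one direction ★ S13c `upDom_of_upDef` consumes. [cite: Rogawski1990, §12.5 p. 183; §4.3 p. 42] -/
theorem hRegH_of_pin {G : Type} [Group G] [TopologicalSpace G] [IsTopologicalGroup G] [MeasurableSpace G]
    [∀ γ : G, MeasurableSpace (G ⧸ Subgroup.centralizer ({γ} : Set G))] [MeasurableSpace (G ⧸ Subgroup.center G)]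
    [MeasurableSpace ((UnitaryGroup.cmDatum L 2 (Matrix.of fun i j : Fin 2 => if i.val + j.val + 1 = 2 then (1 : L) else 0)).Local v ×
      (UnitaryGroup.cmDatum L 1 (Matrix.of fun i j : Fin 1 => if i.val + j.val + 1 = 1 then (1 : L) else 0)).Local v)]
    (𝔇 : Ch12Sec5.EllipticData G
      ((UnitaryGroup.cmDatum L 2 (Matrix.of fun i j : Fin 2 => if i.val + j.val + 1 = 2 then (1 : L) else 0)).Local v ×
        (UnitaryGroup.cmDatum L 1 (Matrix.of fun i j : Fin 1 => if i.val + j.val + 1 = 1 then (1 : L) else 0)).Local v))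
    (hRegH' : ∀ a, a ∈ 𝔇.regH ↔ IsLocalGRegular L v a) :
    ∀ a, IsLocalGRegular L v a → a ∈ 𝔇.regH :=
  fun a ha => (hRegH' a).2 ha

end Summit.HodgeConjecture.HodgeConjecture.Cruxes.H413.F0P3cStCharTSDHStable

end
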